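import Summits.Ventures.Crystal3D.Theorems.StickyWulffConstantPolycrystalWulffBoundRungSuperTreeTexture

/-!
# `PolycrystalWulffBound`, line `PolyDensity`: a parent grain with SLID TWIN COLONIES about several axes,
# in the crux's own energy (`rung_slidColonies_texture`; crux `stmt-Ventures-19482`)

Route `StickyWulffConstant` of the venture `Summits/Ventures/Crystal3D`, second prover lane (poly-p2,
gen 13).  Texture (En) form of `rung_slidColonies`: a crux texture `Tex n G A c m` presented by cells;
GRAINS sorted into the core (`col f = 0`, body of `A₀`) and `q` colonies (`col f = i.succ`; a parent cap
layer that belongs to a colony is to be presented as a separate grain with the parent's frame — equal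
lattices are free in `Tex`); colony `i` above the cap plane `⟪x, axS i.succ⟫ = t i`, the core below it
wherever `δ`-close, colonies pairwise `δ`-apart; colony grains co-axial with `A₀` and pairwise about
`axS i.succ`, Bool labels = lattice classes inside a colony, wall data `m f g = axS (col f)` across the
classes, one (bond, `⟨112⟩`) pair `(uS F, wS F)` per colony, and the aggregate azimuth test with the
colony-wise directions ⇒ `6·2^{1/3}(√2·Vol)^{2/3} ≤ En n G A c m`.  Star-tree instance of
`rung_superTree_texture` (one reference frame, profile condition `rfl`).
WHAT THIS IS NOT: colonies touching each other; the crux is not claimed.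
-/

noncomputable section

open scoped BigOperators InnerProductSpace ENNReal Pointwise
open MeasureTheory Filter Set

namespace Summit.Ventures.Crystal3D.Cruxes.PolycrystalWulffBound.PolyDensity

open Summit.Ventures.Crystal3D.Theorems
open Summit.Ventures.Crystal3D.Cruxes.TextureLiminf.TexShadow (per polytope facetArea supportFn E3)
open Literature.MathematicalPhysics.StatisticalMechanics (fccStacking barlowStacking IsHaggSeq perimeter)

/-- **Rung `rung_slidColonies_texture`**: a parent with single-axis twin colonies about several axes,
passing the colony-wise aggregate azimuth test, satisfies `6·2^{1/3}(√2·Vol)^{2/3} ≤ En`. -/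
theorem rung_slidColonies_texture :
    let Λ : Set (EuclideanSpace ℝ (Fin 3)) := Literature.MathematicalPhysics.StatisticalMechanics.fccStacking 1 (Real.sqrt (2 / 3));
    let Brl : (ℤ → ℤ) → Set (EuclideanSpace ℝ (Fin 3)) := Literature.MathematicalPhysics.StatisticalMechanics.barlowStacking 1 (Real.sqrt (2 / 3));
    let Ax : EuclideanSpace ℝ (Fin 3) → (EuclideanSpace ℝ (Fin 3) ≃ₗᵢ[ℝ] EuclideanSpace ℝ (Fin 3)) → (EuclideanSpace ℝ (Fin 3) ≃ₗᵢ[ℝ] EuclideanSpace ℝ (Fin 3)) → Prop := fun m A B => ∃ (L : EuclideanSpace ℝ (Fin 3) ≃ₗᵢ[ℝ] EuclideanSpace ℝ (Fin 3)) (s₁ s₂ : EuclideanSpace ℝ (Fin 3)) (σ σ' : ℤ → ℤ), Literature.MathematicalPhysics.StatisticalMechanics.IsHaggSeq σ ∧ Literature.MathematicalPhysics.StatisticalMechanics.IsHaggSeq σ' ∧ L (EuclideanSpace.single (2 : Fin 3) (1 : ℝ)) = m ∧ A '' Λ ⊆ (fun q => L q + s₁) '' Brl σ ∧ B '' Λ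 ⊆ (fun q => L q + s₂) '' Brl σ';
    let CoAx : (EuclideanSpace ℝ (Fin 3) ≃ₗᵢ[ℝ] EuclideanSpace ℝ (Fin 3)) → (EuclideanSpace ℝ (Fin 3) ≃ₗᵢ[ℝ] EuclideanSpace ℝ (Fin 3)) → Prop := fun A B => ∃ m, Ax m A B;
    let Φ : EuclideanSpace ℝ (Fin 3) → ℝ := fun ν => Real.sqrt 2 / 4 * ∑ᶠ w ∈ {w ∈ Λ | ‖w‖ = 1}, |⟪w, ν⟫_ℝ|;
    let Per : Set (EuclideanSpace ℝ (Fin 3)) → Set (EuclideanSpace ℝ (Fin 3)) → ℝ := fun K S => (⨆ (ξ : EuclideanSpace ℝ (Fin 3) → EuclideanSpace ℝ (Fin 3)) (_ : ContDiff ℝ 1 ξ ∧ HasCompactSupport ξ ∧ ∀ z, ξ z ∈ K), ENNReal.ofReal (∫ z in S, Literature.MathematicalPhysics.StatisticalMechanics.fieldDivergence ξ z)).toReal;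
    let ι : Set (EuclideanSpace ℝ (Fin 3)) → Set (EuclideanSpace ℝ (Fin 3)) → Set (EuclideanSpace ℝ (Fin 3)) → ℝ := fun K S₁ S₂ => (Per K S₁ + Per K S₂ - Per K (S₁ ∪ S₂)) / 2;
    let W : (EuclideanSpace ℝ (Fin 3) ≃ₗᵢ[ℝ] EuclideanSpace ℝ (Fin 3)) → Set (EuclideanSpace ℝ (Fin 3)) := fun A => {y | ∀ ν : EuclideanSpace ℝ (Fin 3), ⟪y, ν⟫_ℝ ≤ Φ (A.symm ν)};
    let Dsc : EuclideanSpace ℝ (Fin 3) → Set (EuclideanSpace ℝ (Fin 3)) := fun m => {y | ‖y‖ ≤ 1 ∧ ⟪y, m⟫_ℝ = 0};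
    let Tex : (n : ℕ) → (Fin n → Set (EuclideanSpace ℝ (Fin 3))) → (Fin n → (EuclideanSpace ℝ (Fin 3) ≃ₗᵢ[ℝ] EuclideanSpace ℝ (Fin 3))) → (Fin n → Fin n → ℝ) → (Fin n → Fin n → EuclideanSpace ℝ (Fin 3)) → Prop := fun n G A c m => (∀ f : Fin n, Literature.MathematicalPhysics.StatisticalMechanics.HasFinitePerimeter (G f) ∧ volume (G f) < ⊤) ∧ (∀ f g, f ≠ g → Disjoint (G f) (G g)) ∧ (∀ f g, f ≠ g → 0 ≤ c f g) ∧ (∀ f g, f ≠ g → ¬ CoAx (A f) (A g) → m f g = 0 ∧ 1 ≤ c f g) ∧ (∀ f g, f ≠ g → CoAx (A f) (A g) → A f '' Λ ≠ A g '' Λ → Ax (m f g) (A f) (A g) ∧ 1 / 2 ≤ c f g);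
    let En : (n : ℕ) → (Fin n → Set (EuclideanSpace ℝ (Fin 3))) → (Fin n → (EuclideanSpace ℝ (Fin 3) ≃ₗᵢ[ℝ] EuclideanSpace ℝ (Fin 3))) → (Fin n → Fin n → ℝ) → (Fin n → Fin n → EuclideanSpace ℝ (Fin 3)) → ℝ := fun n G A c m => ∑ f : Fin n, Per (W (A f)) (G f) - ∑ f, ∑ g, (if f = g then 0 else ι (W (A f)) (G f) (G g)) + ∑ f, ∑ g, (if f = g then 0 else c f g / 2 * ι (Dsc (m f g)) (G f) (G g));
    let Vol : (n : ℕ) → (Fin n → Set (EuclideanSpace ℝ (Fin 3))) → ℝ := fun n G => (volume (⋃ f : Fin n, G f)).toReal;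
    ∀ (k' : ℕ) (Hc : Fin k' → Finset ((EuclideanSpace ℝ (Fin 3)) × ℝ)) (nv : Fin k' → Fin k' → EuclideanSpace ℝ (Fin 3)),
      (∀ j, Bornology.IsBounded (polytope (Hc j))) →
      (∀ j j', j ≠ j' → Disjoint (polytope (Hc j)) (polytope (Hc j'))) →
      (∀ i j, nv j i = -nv i j) →
      (∀ j j', j ≠ j' → ‖nv j j'‖ = 1 ∧ ∃ b : ℝ,
        closure (polytope (Hc j)) ∩ closure (polytope (Hc j')) ⊆ {x | ⟪nv j j', x⟫_ℝ = b}) →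
    ∀ (n : ℕ) (G : Fin n → Set (EuclideanSpace ℝ (Fin 3)))
      (A : Fin n → (EuclideanSpace ℝ (Fin 3) ≃ₗᵢ[ℝ] EuclideanSpace ℝ (Fin 3)))
      (c : Fin n → Fin n → ℝ) (m : Fin n → Fin n → EuclideanSpace ℝ (Fin 3)),
      Tex n G A c m →
    ∀ (s : Fin n → Finset (Fin k')),
      (∀ f, G f = ⋃ j ∈ s f, polytope (Hc j)) →
      (∀ f g, f ≠ g → Disjoint (s f) (s g)) →
      (∀ j, ∃ f, j ∈ s f) →
    ∀ (τ : Fin n → Bool) (q : ℕ) (col : Fin n → Fin (q + 1))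
      (A₀ : EuclideanSpace ℝ (Fin 3) ≃ₗᵢ[ℝ] EuclideanSpace ℝ (Fin 3)) (t : Fin q → ℝ)
      (axS uS wS : Fin (q + 1) → EuclideanSpace ℝ (Fin 3)) (δ : ℝ),
      (∀ i : Fin q, ‖axS i.succ‖ = 1) → 0 < δ →
      (∀ (i : Fin q) f, col f = i.succ → ∀ x ∈ G f, t i < ⟪x, axS i.succ⟫_ℝ) →
      (∀ (i : Fin q) f, col f = 0 → ∀ x ∈ G f,
        ⟪x, axS i.succ⟫_ℝ < t i ∨ ∀ g, col g = i.succ → ∀ y ∈ G g, δ ≤ dist x y) →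
      (∀ f g, col f ≠ col g → col f ≠ 0 → col g ≠ 0 → ∀ x ∈ G f, ∀ y ∈ G g, δ ≤ dist x y) →
      (∀ f, col f = 0 → W (A f) = W A₀) →
      (∀ f, col f ≠ 0 → Ax (axS (col f)) A₀ (A f)) →
      (∀ f g, col f = col g → col f ≠ 0 → Ax (axS (col f)) (A f) (A g)) →
      (∀ i : Fin q, ‖uS i.succ‖ = 1 ∧ ‖wS i.succ‖ = 1 ∧ ⟪uS i.succ, axS i.succ⟫_ℝ = 0 ∧
        ⟪wS i.succ, axS i.succ⟫_ℝ = 0 ∧ ⟪wS i.succ, uS i.succ⟫_ℝ = 0) →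
      (∀ i : Fin q, uS i.succ ∈ A₀ '' Λ ∧ (ℝ ∙ uS i.succ)ᗮ.reflection '' (A₀ '' Λ) = A₀ '' Λ) →
      (∀ f g, col f = col g → (τ f = τ g ↔ A f '' Λ = A g '' Λ)) →
      (∀ f g, f ≠ g → col f = col g → col f ≠ 0 → τ f ≠ τ g → m f g = axS (col f)) →
      2 / Real.sqrt 6 * ∑ f, ∑ g, (if (col f = col g ∧ col f ≠ 0 ∧ τ f ≠ τ g) then
          ∑ a ∈ s f, ∑ b ∈ s g, |⟪wS (col f), nv a b⟫_ℝ| *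
            facetArea (closure (polytope (Hc a)) ∩ closure (polytope (Hc b))) (nv a b) else 0) ≤
        1 / 2 * ∑ f, ∑ g, (if (col f = col g ∧ col f ≠ 0 ∧ τ f ≠ τ g) then
          ∑ a ∈ s f, ∑ b ∈ s g, Real.sqrt (1 - ⟪nv a b, axS (col f)⟫_ℝ ^ 2) *
            facetArea (closure (polytope (Hc a)) ∩ closure (polytope (Hc b))) (nv a b) else 0) →
    6 * (2 : ℝ) ^ ((1 : ℝ) / 3) * (Real.sqrt 2 * Vol n G) ^ ((2 : ℝ) / 3) ≤ En n G A c m := by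
  intro Λ Brl Ax CoAx Φ Per ι W Dsc Tex En Vol k' Hc nv hbd hdisjQ hanti hplane n G A c m hTex
    s hGs hsdisj hcov τ q col A₀ t axS uS wS δ hax hδ hcol hcore hsepcol hcoreBody hAx0 hAxP hON hBM
    hτ hmax hAz
  -- the star-shaped tree: node `0` = core, node `i.succ` = colony `i`
  set slid : Fin (q + 1) → Bool := fun F => Fin.cases (motive := fun _ => Bool) false (fun _ => true) F
    with hslid
  have hslid0 : slid 0 = false := by simp [hslid]
  have hslidS : ∀ i : Fin q, slid i.succ = true := fun i => by simp [hslid]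
  have hslid_iff : ∀ F, slid F = true ↔ F ≠ 0 := by
    intro F
    refine Fin.cases ?_ (fun i => ?_) F
    · rw [hslid0]; simp
    · rw [hslidS]; simp [Fin.succ_ne_zero]
  have hsucc_of : ∀ F : Fin (q + 1), slid F = true → ∃ i : Fin q, F = i.succ := by
    intro F hF
    rcases Fin.eq_zero_or_eq_succ F with h | h
    · rw [h, hslid0] at hF; exact Bool.noConfusion hF
    · exact h
  have hfar : ∀ f g, col f ≠ col g → (∀ i : Fin q, ¬ (col f = 0 ∧ col g = i.succ)) →
      (∀ i : Fin q, ¬ (col g = 0 ∧ col f = i.succ)) → ∀ x ∈ G f, ∀ y ∈ G g, δ ≤ dist x y := by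
    intro f g hne h1 h2 x hx y hy
    have hf : col f ≠ 0 := by
      intro h0
      rcases Fin.eq_zero_or_eq_succ (col g) with h' | ⟨i, hi⟩
      · exact hne (h0.trans h'.symm)
      · exact h1 i ⟨h0, hi⟩
    have hg : col g ≠ 0 := by
      intro h0
      rcases Fin.eq_zero_or_eq_succ (col f) with h' | ⟨i, hi⟩
      · exact hne (h'.trans h0.symm)
      · exact h2 i ⟨h0, hi⟩
    exact hsepcol f g hne hf hg x hx y hy
  have hR := rung_superTree_texture k' Hc nv hbd hdisjQ hanti hplane n G A c m hTex s hGs hsdisj hcov τ q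
    (fun _ => 0) (fun i => axS i.succ) t col (fun _ => A₀) slid axS uS wS δ
    (fun i => Nat.zero_le _) hax (fun _ _ => rfl) hcol hδ hcore hfar
    (fun f hf => by
      rcases Fin.eq_zero_or_eq_succ (col f) with h | ⟨i, hi⟩
      · exact hcoreBody f h
      · rw [hi, hslidS] at hf; exact Bool.noConfusion hf)
    (fun f hf => hAx0 f ((hslid_iff _).1 hf))
    (fun f g hfg hf => hAxP f g hfg ((hslid_iff _).1 hf))
    (fun F hF => by obtain ⟨i, rfl⟩ := hsucc_of F hF; exact hON i)
    (fun F hF => by obtain ⟨i, rfl⟩ := hsucc_of F hF; exact hBM i)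
    hτ (fun f g hfg hc hf hne => hmax f g hfg hc ((hslid_iff _).1 hf) hne)
    (fun i h => by rw [hslid0] at h; exact Bool.noConfusion h)
    (fun i _ => by rw [real_inner_comm]; exact (hON i).2.2.2.1)
  -- translate the azimuth test: `slid (col f) = true ↔ col f ≠ 0`
  set fa : Fin k' → Fin k' → ℝ := fun a b =>
    facetArea (closure (polytope (Hc a)) ∩ closure (polytope (Hc b))) (nv a b) with hfa
  have e1 : (∑ f, ∑ g, (if (col f = col g ∧ slid (col f) = true ∧ τ f ≠ τ g) then
      ∑ a ∈ s f, ∑ b ∈ s g, |⟪wS (col f), nv a b⟫_ℝ| * fa a b else 0)) =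
      ∑ f, ∑ g, (if (col f = col g ∧ col f ≠ 0 ∧ τ f ≠ τ g) then
        ∑ a ∈ s f, ∑ b ∈ s g, |⟪wS (col f), nv a b⟫_ℝ| * fa a b else 0) :=
    Finset.sum_congr rfl fun f _ => Finset.sum_congr rfl fun g _ => if_congr (by rw [hslid_iff]) rfl rfl
  have e2 : (∑ f, ∑ g, (if (col f = col g ∧ slid (col f) = true ∧ τ f ≠ τ g) then
      ∑ a ∈ s f, ∑ b ∈ s g, Real.sqrt (1 - ⟪nv a b, axS (col f)⟫_ℝ ^ 2) * fa a b else 0)) =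
      ∑ f, ∑ g, (if (col f = col g ∧ col f ≠ 0 ∧ τ f ≠ τ g) then
        ∑ a ∈ s f, ∑ b ∈ s g, Real.sqrt (1 - ⟪nv a b, axS (col f)⟫_ℝ ^ 2) * fa a b else 0) :=
    Finset.sum_congr rfl fun f _ => Finset.sum_congr rfl fun g _ => if_congr (by rw [hslid_iff]) rfl rfl
  rw [e1, e2] at hR
  exact hR hAz

end Summit.Ventures.Crystal3D.Cruxes.PolycrystalWulffBound.PolyDensity

end
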